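import Literature.MathematicalPhysics.QuantumLattice.SectorisedKernelNormPrescribedBridge
import HarnessLib

/-!
# Prescribed-legs sector sums, II: the SWAPPED bridge — a position-ONLY pin (sector summed) on a translation-invariant kernel reads the
# standard prescribed datum ONE LEVEL LOWER

Topic `MathematicalPhysics/QuantumLattice`; companion of `SectorisedKernelNormPrescribedBridge` (the standard bridge: the Grassmann supplier's input
hypothesis `Σ_{Y : Y t = a} ‖K Y‖ · ∏_{j : T} [A j (Y (ι j))] ≤ N |T|` — ONE slot `t` pinned at a FULL label `a = (x, σ)`, the slots of `T` sector-prescribed —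
from the sectorised `(E, τ)`-filter sums `ε^m Σ_{σ|_E = τ|_E} Σ_{x : x_p = y} ‖W σ x‖` with `|E| = F + 1 ∋ p`).

Benfatto–Giuliani–Mastropietro 2006, App. A4 (A4.8): along a line of the tree expansion the sector sum may be moved from the parent side to the child side,
`Σ_{ω}[ξ-part(ω)]·[η-part(ω)] ≤ sup_ω[ξ-part] · Σ_ω[η-part]` — the child subtree is then read with its root-ward slot pinned in POSITION ONLY, its sector SUMMED,
while its other external slots stay sector-prescribed.  For a kernel that is TRANSLATION INVARIANT in the positions (every kernel of a frequency– and
momentum-conserving polynomial on the space-time torus, BGM 2006 §2.3 (2.17)) the position fibre `{x : x_p = y}` of ANY leg `p` at ANY point `y` carries the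
same sum, so the position-only pin can be moved onto one of the PRESCRIBED legs: the swapped sum with `|T| = F + 1` prescribed slots IS a standard
`(E′, τ)`-filter sum with `E′ = range ι`, `|E′| = F + 1`, pinned inside `E′` — it reads the standard bound `B(F)`, one level below the standard pin's `B(F + 1)`.

Generic layer (labels `P × S`, `P` a finite additive group acting on the position tuples by `x ↦ (x_i + a)_i`, real-valued size function `Φ σ x`, e.g.
`‖W σ x‖` or `wl(x, σ)·‖W σ x‖`):
* `sum_filter_apply_eq_of_translate` — for a translation-invariant `g` on position tuples the fibre sums `Σ_{x : x_p = y} g x` do not depend on `(p, y)`;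
* `sum_prescribedSlots_eq'` / `sum_posPinnedSlots_eq` — the supplier's indicator sums (full pin / position-only pin) in sectorised currency;
  `sum_sum_prescribedSlots_eq_posPinnedSlots` — summing the full-pin sums over the pin's sector gives the position-only-pin sum (any summand);
  `sum_prescribedSlots_translate` — the full-pin sum does not depend on the pin's position;
* **`sum_posPinned_prescribedSum_le_of_prescribedSum_le`** — `(E, τ)` currency: the standard hypothesis at `|E| = F + 1 ∋ p` bounds the `(E, τ)`-filter sum
  pinned at ANY leg `q` (in `E` or not);
* **`sum_posPinnedSlots_le_of_prescribedSum_le`** — supplier currency: the standard hypothesis at `F` bounds the position-only-pinned indicator sum with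
  `|T| = F + 1` prescribed slots (`ι` injective; no condition relating `t` and `range ι`);
* the `‖W‖` specialisations `sum_norm_posPinnedSlots_eq`, `sum_norm_posPinned_prescribedSum_le_of_prescribedSum_le`, `sum_norm_posPinnedSlots_le_of_prescribedSum_le`;
* the `∃ g` (sector-profile) packaging of the swapped input — the literal `hKsw` shape of the oriented tree-decay lemma
  (`KernelTreeDecayOriented`): `exists_sectorProfile_of_prescribedSum_le`, `exists_sectorProfile_kernel_sectorPreimage_of_prescribedSum_le` (one level
  lower, `|T| = F + 1`) and the crude same-level companions `…_card` (`|T| = F`, `Σ g ≤ |S|·B`; for vertices with no prescribed slot to re-pin at);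
* the Hubbard forms for `K = kernel (sectorPreimage β F G) (m+1)` (`= ε_x^{m+1}·W_{F,σ}(x)`): `sum_norm_kernel_sectorPreimage_posPinnedSlots_eq` and
  **`sum_norm_kernel_sectorPreimage_posPinnedSlots_le_of_prescribedSum_le`** (translation invariance of the sectorised kernels of `G` as a hypothesis —
  discharged on the programme side by conservation of frequency and momentum).

Cell gate-hubbard-kl, K3 engine stub (b) (ℓ), located-risk #10 «(ℓ)-LEV-ODD», cure (ε) design v2 §1/§4: this is «how a model-side prover discharges `hNsw`»,
the one new input hypothesis of the ORIENTED prescribed bracket.  Everything is proved; no definition.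

## Sources

G. Benfatto, A. Giuliani, V. Mastropietro, Ann. Henri Poincaré 7 (2006) 809–898, §2.3 (2.17), §2.8 (2.88)–(2.90), App. A3 Lemma A3.1, App. A4 (A4.5)–(A4.8)
[`BenfattoGiulianiMastropietro2006`].
-/

noncomputable section

namespace Literature.MathematicalPhysics.QuantumLattice

open Finset

section Generic

variable {S P : Type*} [Fintype S] [DecidableEq S] [Fintype P] [DecidableEq P] {ι₀ : Type*}

omit [DecidableEq S] [DecidableEq P] in
/-- Splitting a sum over tuples of (position, label) pairs into the label tuples and the position tuples. [folklore] -/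
private theorem sum_tuple_prod_eq_sum_sum_sw {α : Type*} [AddCommMonoid α] (n : ℕ)
    (g : (Fin n → P × S) → α) : ∑ Y, g Y = ∑ σ : Fin n → S, ∑ x : Fin n → P, g (fun i => (x i, σ i)) := by
  rw [← (Equiv.arrowProdEquivProdArrow (Fin n) (fun _ => P) (fun _ => S)).symm.sum_comp, Fintype.sum_prod_type, sum_comm]
  rfl

/-! ### Translation invariance: fibre sums of any leg at any point agree -/

/-- **For a translation-invariant function of position tuples the fibre sum `Σ_{x : x_p = y} g x` depends neither on the leg `p` nor on the point `y`**
(`g (x_i + a)_i = g x` for every shift `a` of the finite additive group `P`): `Σ_{x : x_p = y} g x = Σ_{x : x_q = z} g x`.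
(Each fibre of leg `p` is a translate of any other, so all `|P|` fibres of `p` carry the same sum, namely `|P|⁻¹ Σ_x g x` — for every `p`; BGM's `L¹–L^∞` norm (2.76) holds «one point fixed», immaterial which for a translation-invariant
kernel.) [cite: BenfattoGiulianiMastropietro2006, §2.8 (2.76) and App. A4 (A4.8)] -/
theorem sum_filter_apply_eq_of_translate [AddGroup P] {α : Type*} [Field α] [CharZero α] {m : ℕ} (g : (Fin (m + 1) → P) → α)
    (hg : ∀ (x : Fin (m + 1) → P) (a : P), g (fun i => x i + a) = g x) (p q : Fin (m + 1)) (y z : P) :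
    ∑ x ∈ univ.filter (fun x : Fin (m + 1) → P => x p = y), g x = ∑ x ∈ univ.filter (fun x : Fin (m + 1) → P => x q = z), g x := by
  classical
  -- (1) at a fixed leg the fibre sum does not depend on the point
  have hpin : ∀ (r : Fin (m + 1)) (u v : P), ∑ x ∈ univ.filter (fun x : Fin (m + 1) → P => x r = u), g x =
      ∑ x ∈ univ.filter (fun x : Fin (m + 1) → P => x r = v), g x := by
    intro r u v
    set a : P := -u + v with ha
    refine Finset.sum_equiv (Equiv.addRight (fun _ : Fin (m + 1) => a)) (fun x => ?_) (fun x _ => ?_)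
    · simp only [mem_filter, mem_univ, true_and, Equiv.coe_addRight, Pi.add_apply]
      constructor
      · intro h; rw [h, ha, add_neg_cancel_left]
      · intro h
        rw [← eq_add_neg_iff_add_eq] at h
        rw [h, ha, neg_add_rev, neg_neg, add_neg_cancel_left]
    · rw [Equiv.coe_addRight]
      exact (hg x a).symm
  -- (2) the total is `|P| ×` the fibre sum, for every leg
  have htot : ∀ (r : Fin (m + 1)) (u : P), ∑ x : Fin (m + 1) → P, g x =
      (Fintype.card P : α) * ∑ x ∈ univ.filter (fun x : Fin (m + 1) → P => x r = u), g x := by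
    intro r u
    rw [← Finset.sum_fiberwise univ (fun x : Fin (m + 1) → P => x r) g, sum_congr rfl fun v _ => hpin r v u, sum_const, card_univ,
      nsmul_eq_mul]
  haveI : Nonempty P := ⟨y⟩
  have hcard : (Fintype.card P : α) ≠ 0 := by exact_mod_cast Fintype.card_ne_zero
  exact mul_left_cancel₀ hcard ((htot p y).symm.trans (htot q z))

/-! ### The supplier's indicator sums in sectorised currency -/

/-- **The supplier's FULL-PIN indicator sum in sectorised currency** (real-valued size function `Φ`): for a set `T` of constrained slots injected by `ι`
into the legs with prescribed sectors `s` and one slot `t` pinned at `a = (y, σ₀)`,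
`Σ_{Y : Y t = a} Φ(sec∘Y, pos∘Y) · ∏_{j : T} [ (Y (ι j)).2 = s j ] = Σ_{σ : σ t = a.2 ∧ ∀ j, σ (ι j) = s j} Σ_{x : x t = a.1} Φ σ x`
(`sum_norm_prescribedSlots_eq` is the case `Φ σ x = ‖W σ x‖`). [cite: BenfattoGiulianiMastropietro2006, §2.7 (2.70) and §2.8 (2.88)-(2.90)] -/
theorem sum_prescribedSlots_eq' {m : ℕ} (Φ : (Fin (m + 1) → S) → (Fin (m + 1) → P) → ℝ) (T : Finset ι₀)
    (ι : T → Fin (m + 1)) (s : T → S) (t : Fin (m + 1)) (a : P × S) :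
    ∑ Y ∈ univ.filter (fun Y : Fin (m + 1) → P × S => Y t = a),
        Φ (fun i => (Y i).2) (fun i => (Y i).1) * ∏ j : T, (if (Y (ι j)).2 = s j then (1 : ℝ) else 0) =
      ∑ σ ∈ univ.filter (fun σ : Fin (m + 1) → S => σ t = a.2 ∧ ∀ j : T, σ (ι j) = s j),
        ∑ x ∈ univ.filter (fun x : Fin (m + 1) → P => x t = a.1), Φ σ x := by
  classical
  rw [sum_filter, sum_tuple_prod_eq_sum_sum_sw (m + 1), sum_filter]
  refine sum_congr rfl fun σ _ => ?_
  have hprod : ∀ x : Fin (m + 1) → P,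
      (∏ j : T, (if ((fun i => (x i, σ i)) (ι j)).2 = s j then (1 : ℝ) else 0)) = if ∀ j : T, σ (ι j) = s j then 1 else 0 := by
    intro x
    simp only
    split_ifs with h
    · exact prod_eq_one fun j _ => if_pos (h j)
    · push Not at h
      obtain ⟨j, hj⟩ := h
      exact prod_eq_zero (mem_univ j) (if_neg hj)
  simp_rw [hprod]
  by_cases hσ : σ t = a.2 ∧ ∀ j : T, σ (ι j) = s j
  · rw [if_pos hσ, sum_filter]
    refine sum_congr rfl fun x _ => ?_
    rw [if_pos hσ.2, mul_one]
    simp only [Prod.ext_iff, hσ.1, and_true]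
  · rw [if_neg hσ]
    refine sum_eq_zero fun x _ => ?_
    by_cases hx : (fun i => (x i, σ i)) t = a
    · rw [if_pos hx]
      have hσt : σ t = a.2 := (Prod.ext_iff.1 hx).2
      have hnot : ¬ ∀ j : T, σ (ι j) = s j := fun h => hσ ⟨hσt, h⟩
      rw [if_neg hnot, mul_zero]
    · rw [if_neg hx]

/-- **The supplier's POSITION-ONLY-PIN indicator sum in sectorised currency**: with the slot `t` pinned at the POINT `y` only (its sector summed),
`Σ_{Y : (Y t).1 = y} Φ(sec∘Y, pos∘Y) · ∏_{j : T} [ (Y (ι j)).2 = s j ] = Σ_{σ : ∀ j, σ (ι j) = s j} Σ_{x : x t = y} Φ σ x`.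
[cite: BenfattoGiulianiMastropietro2006, §2.8 (2.88)-(2.90), App. A4 (A4.8)] -/
theorem sum_posPinnedSlots_eq {m : ℕ} (Φ : (Fin (m + 1) → S) → (Fin (m + 1) → P) → ℝ) (T : Finset ι₀)
    (ι : T → Fin (m + 1)) (s : T → S) (t : Fin (m + 1)) (y : P) :
    ∑ Y ∈ univ.filter (fun Y : Fin (m + 1) → P × S => (Y t).1 = y),
        Φ (fun i => (Y i).2) (fun i => (Y i).1) * ∏ j : T, (if (Y (ι j)).2 = s j then (1 : ℝ) else 0) =
      ∑ σ ∈ univ.filter (fun σ : Fin (m + 1) → S => ∀ j : T, σ (ι j) = s j),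
        ∑ x ∈ univ.filter (fun x : Fin (m + 1) → P => x t = y), Φ σ x := by
  classical
  rw [sum_filter, sum_tuple_prod_eq_sum_sum_sw (m + 1), sum_filter]
  refine sum_congr rfl fun σ _ => ?_
  have hprod : ∀ x : Fin (m + 1) → P,
      (∏ j : T, (if ((fun i => (x i, σ i)) (ι j)).2 = s j then (1 : ℝ) else 0)) = if ∀ j : T, σ (ι j) = s j then 1 else 0 := by
    intro x
    simp only
    split_ifs with h
    · exact prod_eq_one fun j _ => if_pos (h j)
    · push Not at h
      obtain ⟨j, hj⟩ := h
      exact prod_eq_zero (mem_univ j) (if_neg hj)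
  simp_rw [hprod]
  by_cases hσ : ∀ j : T, σ (ι j) = s j
  · simp only [if_pos hσ, mul_one, sum_filter]
  · simp only [if_neg hσ, mul_zero, ite_self, sum_const_zero]

omit [DecidableEq S] [Fintype P] in
/-- **Summing the full-pin sums over the pin's sector gives the position-only-pin sum** (any summand `f`, any number of legs `n`):
`Σ_{σ₀} Σ_{Y : Y t = (y, σ₀)} f Y = Σ_{Y : (Y t).1 = y} f Y` (the sector sum of (A4.8) moved onto the child's root slot).
[cite: BenfattoGiulianiMastropietro2006, App. A4 (A4.8)] -/
theorem sum_sum_prescribedSlots_eq_posPinnedSlots [DecidableEq S] [Fintype P] {α : Type*} [AddCommMonoid α] {n : ℕ}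
    (f : (Fin n → P × S) → α) (t : Fin n) (y : P) :
    ∑ σ₀ : S, ∑ Y ∈ univ.filter (fun Y : Fin n → P × S => Y t = (y, σ₀)), f Y =
      ∑ Y ∈ univ.filter (fun Y : Fin n → P × S => (Y t).1 = y), f Y := by
  classical
  rw [← Finset.sum_fiberwise (univ.filter fun Y : Fin n → P × S => (Y t).1 = y) (fun Y => (Y t).2) f]
  refine sum_congr rfl fun σ₀ _ => sum_congr ?_ fun _ _ => rfl
  ext Y
  simp only [mem_filter, mem_univ, true_and, Prod.ext_iff]

/-- **The full-pin indicator sum does not depend on the pin's POSITION** for a translation-invariant size function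
(`Φ σ (x_i + a)_i = Φ σ x`): `Σ_{Y : Y t = (y, σ₀)} Φ · ∏[…] = Σ_{Y : Y t = (y′, σ₀)} Φ · ∏[…]` (the «one point fixed» of (2.76) is any point).
[cite: BenfattoGiulianiMastropietro2006, §2.8 (2.76)] -/
theorem sum_prescribedSlots_translate [AddGroup P] {m : ℕ} (Φ : (Fin (m + 1) → S) → (Fin (m + 1) → P) → ℝ)
    (hΦ : ∀ (σ : Fin (m + 1) → S) (x : Fin (m + 1) → P) (a : P), Φ σ (fun i => x i + a) = Φ σ x) (T : Finset ι₀)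
    (ι : T → Fin (m + 1)) (s : T → S) (t : Fin (m + 1)) (σ₀ : S) (y y' : P) :
    ∑ Y ∈ univ.filter (fun Y : Fin (m + 1) → P × S => Y t = (y, σ₀)),
        Φ (fun i => (Y i).2) (fun i => (Y i).1) * ∏ j : T, (if (Y (ι j)).2 = s j then (1 : ℝ) else 0) =
      ∑ Y ∈ univ.filter (fun Y : Fin (m + 1) → P × S => Y t = (y', σ₀)),
        Φ (fun i => (Y i).2) (fun i => (Y i).1) * ∏ j : T, (if (Y (ι j)).2 = s j then (1 : ℝ) else 0) := by
  rw [sum_prescribedSlots_eq' Φ T ι s t (y, σ₀), sum_prescribedSlots_eq' Φ T ι s t (y', σ₀)]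
  exact sum_congr rfl fun σ _ => sum_filter_apply_eq_of_translate (Φ σ) (hΦ σ) t t y y'

/-! ### The swapped bridge -/

/-- **`(E, τ)` CURRENCY: for a translation-invariant size function the `(E, τ)`-filter sum may be pinned at ANY leg.**  If
`ε^m Σ_{σ : σ|_E = τ|_E} Σ_{x : x_p = y} Φ σ x ≤ B` for all `E ∋ p` with `|E| = F + 1`, all `τ`, `y` (the standard hypothesis of the prescribed bridge), then for
every `E` with `|E| = F + 1`, every `τ`, EVERY leg `q` (in `E` or not) and every point `y`: `ε^m Σ_{σ : σ|_E = τ|_E} Σ_{x : x_q = y} Φ σ x ≤ B`.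
[cite: BenfattoGiulianiMastropietro2006, §2.8 (2.88)-(2.90), App. A4 (A4.8)] -/
theorem sum_posPinned_prescribedSum_le_of_prescribedSum_le [AddGroup P] {ε : ℝ} {m : ℕ} (Φ : (Fin (m + 1) → S) → (Fin (m + 1) → P) → ℝ)
    (hΦ : ∀ (σ : Fin (m + 1) → S) (x : Fin (m + 1) → P) (a : P), Φ σ (fun i => x i + a) = Φ σ x) {F : ℕ} {B : ℝ}
    (hB : ∀ (E : Finset (Fin (m + 1))) (τ : Fin (m + 1) → S) (p : Fin (m + 1)), p ∈ E → E.card = F + 1 → ∀ y : P,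
      ε ^ m * ∑ σ ∈ univ.filter (fun σ : Fin (m + 1) → S => ∀ e ∈ E, σ e = τ e),
        ∑ x ∈ univ.filter (fun x : Fin (m + 1) → P => x p = y), Φ σ x ≤ B)
    (E : Finset (Fin (m + 1))) (τ : Fin (m + 1) → S) (hE : E.card = F + 1) (q : Fin (m + 1)) (y : P) :
    ε ^ m * ∑ σ ∈ univ.filter (fun σ : Fin (m + 1) → S => ∀ e ∈ E, σ e = τ e),
        ∑ x ∈ univ.filter (fun x : Fin (m + 1) → P => x q = y), Φ σ x ≤ B := by
  have hne : E.Nonempty := by rw [← card_pos, hE]; exact Nat.succ_pos F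
  obtain ⟨p, hp⟩ := hne
  rw [sum_congr rfl fun σ _ => sum_filter_apply_eq_of_translate (Φ σ) (hΦ σ) q p y y]
  exact hB E τ p hp hE y

/-- The slot constraints ALONE are a prescription on the leg set `range ι`: `{σ : ∀ j, σ (ι j) = s j} = {σ : ∀ e ∈ image ι, σ e = τ e}` for any `τ` with
`τ (ι j) = s j` (the prescribed-sector bookkeeping of (2.88)–(2.90) without the pinned leg). [cite: BenfattoGiulianiMastropietro2006, §2.8 (2.88)-(2.90)] -/
theorem posPinnedSlots_filter_eq {m : ℕ} (T : Finset ι₀) (ι : T → Fin (m + 1)) (s : T → S) (τ : Fin (m + 1) → S)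
    (hτι : ∀ j : T, τ (ι j) = s j) :
    univ.filter (fun σ : Fin (m + 1) → S => ∀ j : T, σ (ι j) = s j) =
      univ.filter (fun σ : Fin (m + 1) → S => ∀ e ∈ (univ : Finset T).image ι, σ e = τ e) := by
  classical
  ext σ
  simp only [mem_filter, mem_univ, true_and, mem_image]
  constructor
  · rintro h e ⟨j, rfl⟩
    rw [hτι j]
    exact h j
  · intro h j
    rw [← hτι j]
    exact h (ι j) ⟨j, rfl⟩

/-- **SUPPLIER CURRENCY — THE SWAPPED BRIDGE**: for a translation-invariant size function `Φ`, the standard hypothesis at `F`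
(`ε^m Σ_{σ|_E = τ|_E} Σ_{x_p = y} Φ σ x ≤ B` whenever `|E| = F + 1 ∋ p`) bounds the POSITION-ONLY-PINNED indicator sum with `|T| = F + 1` prescribed slots
(`ι` injective; the pinned slot `t` is arbitrary): `ε^m · Σ_{Y : (Y t).1 = y} Φ(sec∘Y, pos∘Y) · ∏_{j : T} [ (Y (ι j)).2 = s j ] ≤ B` — the swapped line step's child
datum is the standard datum ONE LEVEL LOWER (`|T| = F + 1` prescribed slots read `B(F)`, where the standard full pin with `|T| = F` reads `B(F)`).
[cite: BenfattoGiulianiMastropietro2006, §2.8 (2.88)-(2.90), App. A3 Lemma A3.1, App. A4 (A4.8)] -/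
theorem sum_posPinnedSlots_le_of_prescribedSum_le [AddGroup P] {ε : ℝ} {m : ℕ} (Φ : (Fin (m + 1) → S) → (Fin (m + 1) → P) → ℝ)
    (hΦ : ∀ (σ : Fin (m + 1) → S) (x : Fin (m + 1) → P) (a : P), Φ σ (fun i => x i + a) = Φ σ x) {F : ℕ} {B : ℝ}
    (hB : ∀ (E : Finset (Fin (m + 1))) (τ : Fin (m + 1) → S) (p : Fin (m + 1)), p ∈ E → E.card = F + 1 → ∀ y : P,
      ε ^ m * ∑ σ ∈ univ.filter (fun σ : Fin (m + 1) → S => ∀ e ∈ E, σ e = τ e),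
        ∑ x ∈ univ.filter (fun x : Fin (m + 1) → P => x p = y), Φ σ x ≤ B)
    (T : Finset ι₀) (hT : T.card = F + 1) (ι : T → Fin (m + 1)) (hι : Function.Injective ι) (t : Fin (m + 1)) (s : T → S) (y : P) :
    ε ^ m * ∑ Y ∈ univ.filter (fun Y : Fin (m + 1) → P × S => (Y t).1 = y),
        Φ (fun i => (Y i).2) (fun i => (Y i).1) * ∏ j : T, (if (Y (ι j)).2 = s j then (1 : ℝ) else 0) ≤ B := by
  classical
  have hTne : T.Nonempty := by rw [← card_pos, hT]; exact Nat.succ_pos F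
  obtain ⟨j₀, hj₀⟩ := hTne
  -- an extension of the prescription to all legs
  set τ : Fin (m + 1) → S := fun e => if h : ∃ j : T, ι j = e then s (Classical.choose h) else s ⟨j₀, hj₀⟩ with hτ
  have hτι : ∀ j : T, τ (ι j) = s j := by
    intro j
    have hex : ∃ j' : T, ι j' = ι j := ⟨j, rfl⟩
    simp only [hτ]
    rw [dif_pos hex, hι (Classical.choose_spec hex)]
  have hcard : ((univ : Finset T).image ι).card = F + 1 := by
    rw [card_image_of_injective _ hι, card_univ, Fintype.card_coe, hT]
  rw [sum_posPinnedSlots_eq Φ T ι s t y, posPinnedSlots_filter_eq T ι s τ hτι]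
  exact sum_posPinned_prescribedSum_le_of_prescribedSum_le Φ hΦ hB _ τ hcard t y

/-! ### The `‖W‖` specialisations -/

variable {𝕜 : Type*} [RCLike 𝕜]

/-- `sum_posPinnedSlots_eq` for `Φ σ x = ‖W σ x‖`. [cite: BenfattoGiulianiMastropietro2006, §2.8 (2.88)-(2.90), App. A4 (A4.8)] -/
theorem sum_norm_posPinnedSlots_eq {m : ℕ} (W : (Fin (m + 1) → S) → (Fin (m + 1) → P) → 𝕜) (T : Finset ι₀)
    (ι : T → Fin (m + 1)) (s : T → S) (t : Fin (m + 1)) (y : P) :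
    ∑ Y ∈ univ.filter (fun Y : Fin (m + 1) → P × S => (Y t).1 = y),
        ‖W (fun i => (Y i).2) (fun i => (Y i).1)‖ * ∏ j : T, (if (Y (ι j)).2 = s j then (1 : ℝ) else 0) =
      ∑ σ ∈ univ.filter (fun σ : Fin (m + 1) → S => ∀ j : T, σ (ι j) = s j),
        ∑ x ∈ univ.filter (fun x : Fin (m + 1) → P => x t = y), ‖W σ x‖ :=
  sum_posPinnedSlots_eq (fun σ x => ‖W σ x‖) T ι s t y

/-- `sum_posPinned_prescribedSum_le_of_prescribedSum_le` for `Φ σ x = ‖W σ x‖`: the `(E, τ)`-filter sum of a translation-invariant kernel may be pinned at any leg.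
[cite: BenfattoGiulianiMastropietro2006, §2.8 (2.88)-(2.90), App. A4 (A4.8)] -/
theorem sum_norm_posPinned_prescribedSum_le_of_prescribedSum_le [AddGroup P] {ε : ℝ} {m : ℕ} (W : (Fin (m + 1) → S) → (Fin (m + 1) → P) → 𝕜)
    (hW : ∀ (σ : Fin (m + 1) → S) (x : Fin (m + 1) → P) (a : P), ‖W σ (fun i => x i + a)‖ = ‖W σ x‖) {F : ℕ} {B : ℝ}
    (hB : ∀ (E : Finset (Fin (m + 1))) (τ : Fin (m + 1) → S) (p : Fin (m + 1)), p ∈ E → E.card = F + 1 → ∀ y : P,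
      ε ^ m * ∑ σ ∈ univ.filter (fun σ : Fin (m + 1) → S => ∀ e ∈ E, σ e = τ e),
        ∑ x ∈ univ.filter (fun x : Fin (m + 1) → P => x p = y), ‖W σ x‖ ≤ B)
    (E : Finset (Fin (m + 1))) (τ : Fin (m + 1) → S) (hE : E.card = F + 1) (q : Fin (m + 1)) (y : P) :
    ε ^ m * ∑ σ ∈ univ.filter (fun σ : Fin (m + 1) → S => ∀ e ∈ E, σ e = τ e),
        ∑ x ∈ univ.filter (fun x : Fin (m + 1) → P => x q = y), ‖W σ x‖ ≤ B :=
  sum_posPinned_prescribedSum_le_of_prescribedSum_le (fun σ x => ‖W σ x‖) hW hB E τ hE q y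

/-- `sum_posPinnedSlots_le_of_prescribedSum_le` for `Φ σ x = ‖W σ x‖`: **the swapped bridge for a translation-invariant kernel** — the standard
hypothesis at `F` bounds `ε^m · Σ_{Y : (Y t).1 = y} ‖W(sec∘Y)(pos∘Y)‖ · ∏_{j : T} [ (Y (ι j)).2 = s j ]` for `|T| = F + 1`.
[cite: BenfattoGiulianiMastropietro2006, §2.8 (2.88)-(2.90), App. A3 Lemma A3.1, App. A4 (A4.8)] -/
theorem sum_norm_posPinnedSlots_le_of_prescribedSum_le [AddGroup P] {ε : ℝ} {m : ℕ} (W : (Fin (m + 1) → S) → (Fin (m + 1) → P) → 𝕜)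
    (hW : ∀ (σ : Fin (m + 1) → S) (x : Fin (m + 1) → P) (a : P), ‖W σ (fun i => x i + a)‖ = ‖W σ x‖) {F : ℕ} {B : ℝ}
    (hB : ∀ (E : Finset (Fin (m + 1))) (τ : Fin (m + 1) → S) (p : Fin (m + 1)), p ∈ E → E.card = F + 1 → ∀ y : P,
      ε ^ m * ∑ σ ∈ univ.filter (fun σ : Fin (m + 1) → S => ∀ e ∈ E, σ e = τ e),
        ∑ x ∈ univ.filter (fun x : Fin (m + 1) → P => x p = y), ‖W σ x‖ ≤ B)
    (T : Finset ι₀) (hT : T.card = F + 1) (ι : T → Fin (m + 1)) (hι : Function.Injective ι) (t : Fin (m + 1)) (s : T → S) (y : P) :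
    ε ^ m * ∑ Y ∈ univ.filter (fun Y : Fin (m + 1) → P × S => (Y t).1 = y),
        ‖W (fun i => (Y i).2) (fun i => (Y i).1)‖ * ∏ j : T, (if (Y (ι j)).2 = s j then (1 : ℝ) else 0) ≤ B :=
  sum_posPinnedSlots_le_of_prescribedSum_le (fun σ x => ‖W σ x‖) hW hB T hT ι hι t s y

end Generic

/-! ### The Hubbard forms -/

section Hubbard

open GrassmannAlgebra Literature.Probability.LatticeModels

variable {L M : ℕ} [NeZero L] {N : ℕ} {ι₀ : Type*}

/-- **The supplier's position-only-pinned indicator sum for the sector preimage, in sectorised currency**: for `K = kernel (sectorPreimage β F G) (m+1)`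
(`= ε_x^{m+1} · W_{F,σ}(x)`), `Σ_{Y : (Y t).1 = y} ‖K Y‖ · ∏_{j : T} [ (Y (ι j)).2 = s j ] = ε_x · (ε_x^m Σ_{σ : ∀ j, σ (ι j) = s j} Σ_{x : x t = y} ‖W_{F,σ}(x)‖)` (`0 ≤ β`).
[cite: BenfattoGiulianiMastropietro2006, §2.7 (2.70)] -/
theorem sum_norm_kernel_sectorPreimage_posPinnedSlots_eq {β : ℝ} (hβ : 0 ≤ β) (F : Fin N → FreqMomentum L M → ℂ)
    (G : HubbardGrassmann L M) (m : ℕ) (T : Finset ι₀) (ι : T → Fin (m + 1)) (s : T → SectorLeg N) (t : Fin (m + 1))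
    (y : SpaceTimeIdx L M) :
    ∑ Y ∈ univ.filter (fun Y : Fin (m + 1) → SpaceTimeIdx L M × SectorLeg N => (Y t).1 = y),
        ‖kernel ℂ (sectorPreimage β F G) (m + 1) Y‖ * ∏ j : T, (if (Y (ι j)).2 = s j then (1 : ℝ) else 0) =
      imagTimeWeight β M * (imagTimeWeight β M ^ m *
        ∑ σ ∈ univ.filter (fun σ : Fin (m + 1) → SectorLeg N => ∀ j : T, σ (ι j) = s j),
          ∑ x ∈ univ.filter (fun x : Fin (m + 1) → SpaceTimeIdx L M => x t = y), ‖sectorisedKernel L M β F G (m + 1) σ x‖) := by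
  have hε : 0 ≤ imagTimeWeight β M := imagTimeWeight_nonneg hβ M
  have hK : ∀ Y : Fin (m + 1) → SpaceTimeIdx L M × SectorLeg N, ‖kernel ℂ (sectorPreimage β F G) (m + 1) Y‖ =
      ‖((((imagTimeWeight β M : ℝ) : ℂ) ^ (m + 1)) • sectorisedKernel L M β F G (m + 1)) (fun i => (Y i).2) (fun i => (Y i).1)‖ := by
    intro Y
    rw [kernel_sectorPreimage_eq_sectorisedKernel β F G (m + 1) Y, Pi.smul_apply, Pi.smul_apply, smul_eq_mul]
  simp_rw [hK]
  rw [sum_norm_posPinnedSlots_eq (𝕜 := ℂ)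
    ((((imagTimeWeight β M : ℝ) : ℂ) ^ (m + 1)) • sectorisedKernel L M β F G (m + 1)) T ι s t y]
  have hn : ∀ σ x, ‖((((imagTimeWeight β M : ℝ) : ℂ) ^ (m + 1)) • sectorisedKernel L M β F G (m + 1)) σ x‖ =
      imagTimeWeight β M ^ (m + 1) * ‖sectorisedKernel L M β F G (m + 1) σ x‖ := by
    intro σ x
    rw [Pi.smul_apply, Pi.smul_apply, smul_eq_mul, norm_mul, norm_pow, Complex.norm_real, Real.norm_of_nonneg hε]
  simp_rw [hn]
  rw [← mul_assoc, ← pow_succ', mul_sum]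
  exact sum_congr rfl fun σ _ => by rw [mul_sum]

/-- **Discharging the SWAPPED supplier hypothesis for the sector preimage of a translation-invariant polynomial**: if the sectorised kernels of `G` are
translation invariant in norm (`‖W_{F,σ}((x_i + a)_i)‖ = ‖W_{F,σ}(x)‖` — every frequency– and momentum-conserving `G` on the space-time torus) and every
STANDARD sectorised prescribed sum of `W_F(G)` in degree `m + 1` with `Fc + 1` legs held fixed is `≤ B` (`ε_x^m Σ_{σ|_E = τ|_E} Σ_{x_p = y} ‖W_{F,σ}(x)‖ ≤ B` for
`|E| = Fc + 1 ∋ p`), then for every `T` with `|T| = Fc + 1`, injective `ι`, prescribed labels `s`, ANY slot `t` and point `y`: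
`Σ_{Y : (Y t).1 = y} ‖kernel (sectorPreimage β F G) (m+1) Y‖ · ∏_{j : T} [ (Y (ι j)).2 = s j ] ≤ ε_x · B` — the `hNsw` input of the ORIENTED prescribed-leg
Grassmann supplier, read from the SAME data as the standard `hN` one level lower. [cite: BenfattoGiulianiMastropietro2006, §2.8 (2.88)-(2.90), App. A3 Lemma A3.1, App. A4 (A4.8)] -/
theorem sum_norm_kernel_sectorPreimage_posPinnedSlots_le_of_prescribedSum_le [NeZero M] {β : ℝ} (hβ : 0 ≤ β)
    (F : Fin N → FreqMomentum L M → ℂ) (G : HubbardGrassmann L M) (m : ℕ)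
    (hG : ∀ (σ : Fin (m + 1) → SectorLeg N) (x : Fin (m + 1) → SpaceTimeIdx L M) (a : SpaceTimeIdx L M),
      ‖sectorisedKernel L M β F G (m + 1) σ (fun i => ((x i).1 + a.1, (x i).2 + a.2))‖ = ‖sectorisedKernel L M β F G (m + 1) σ x‖)
    {Fc : ℕ} {B : ℝ}
    (hB : ∀ (E : Finset (Fin (m + 1))) (τ : Fin (m + 1) → SectorLeg N) (p : Fin (m + 1)), p ∈ E → E.card = Fc + 1 →
      ∀ y : SpaceTimeIdx L M,
        imagTimeWeight β M ^ m * ∑ σ ∈ univ.filter (fun σ : Fin (m + 1) → SectorLeg N => ∀ e ∈ E, σ e = τ e),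
          ∑ x ∈ univ.filter (fun x : Fin (m + 1) → SpaceTimeIdx L M => x p = y), ‖sectorisedKernel L M β F G (m + 1) σ x‖ ≤ B)
    (T : Finset ι₀) (hT : T.card = Fc + 1) (ι : T → Fin (m + 1)) (hι : Function.Injective ι) (t : Fin (m + 1))
    (s : T → SectorLeg N) (y : SpaceTimeIdx L M) :
    ∑ Y ∈ univ.filter (fun Y : Fin (m + 1) → SpaceTimeIdx L M × SectorLeg N => (Y t).1 = y),
        ‖kernel ℂ (sectorPreimage β F G) (m + 1) Y‖ * ∏ j : T, (if (Y (ι j)).2 = s j then (1 : ℝ) else 0) ≤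
      imagTimeWeight β M * B := by
  classical
  haveI : NeZero (2 * M) := ⟨by have := NeZero.ne M; omega⟩
  have hε : 0 ≤ imagTimeWeight β M := imagTimeWeight_nonneg hβ M
  have hG' : ∀ (σ : Fin (m + 1) → SectorLeg N) (x : Fin (m + 1) → SpaceTimeIdx L M) (a : SpaceTimeIdx L M),
      ‖sectorisedKernel L M β F G (m + 1) σ (fun i => x i + a)‖ = ‖sectorisedKernel L M β F G (m + 1) σ x‖ :=
    fun σ x a => hG σ x a
  rw [sum_norm_kernel_sectorPreimage_posPinnedSlots_eq hβ F G m T ι s t y]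
  refine mul_le_mul_of_nonneg_left ?_ hε
  have h := sum_norm_posPinnedSlots_le_of_prescribedSum_le (𝕜 := ℂ) (sectorisedKernel L M β F G (m + 1)) hG' hB T hT ι hι t s y
  rwa [sum_norm_posPinnedSlots_eq] at h

end Hubbard

/-! ### The `∃ g` (sector-profile) shape of the swapped input — generic and Hubbard forms -/

section Profile

variable {S P : Type*} [Fintype S] [DecidableEq S] [Fintype P] [DecidableEq P] {ι₀ : Type*}

/-- **THE SWAPPED INPUT AS A SECTOR PROFILE** (the `∃ g` shape of the oriented tree-decay lemma's `hKsw`: the child's full-pin sums are bounded by a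
function `g` of the pin's SECTOR alone, and `Σ_σ g σ` by the datum one level lower): for a nonnegative translation-invariant size function `Φ` and the
standard hypothesis at `F`, for every `T` with `|T| = F + 1`, injective `ι`, slot `t` and labels `s` there is `g ≥ 0` on sectors with
`ε^m · Σ_{Y : Y t = a} Φ(sec∘Y, pos∘Y) · ∏_{j : T} [ (Y (ι j)).2 = s j ] ≤ g a.2` for EVERY full label `a` and `Σ_{σ₀} g σ₀ ≤ B`
(`g σ₀ :=` the full-pin sum at the label `(0, σ₀)`; translation invariance makes the pin's position immaterial).
[cite: BenfattoGiulianiMastropietro2006, §2.8 (2.88)-(2.90), App. A4 (A4.8)] -/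
theorem exists_sectorProfile_of_prescribedSum_le [AddGroup P] {ε : ℝ} (hε : 0 ≤ ε) {m : ℕ} (Φ : (Fin (m + 1) → S) → (Fin (m + 1) → P) → ℝ)
    (hΦ0 : ∀ σ x, 0 ≤ Φ σ x) (hΦ : ∀ (σ : Fin (m + 1) → S) (x : Fin (m + 1) → P) (a : P), Φ σ (fun i => x i + a) = Φ σ x) {F : ℕ} {B : ℝ}
    (hB : ∀ (E : Finset (Fin (m + 1))) (τ : Fin (m + 1) → S) (p : Fin (m + 1)), p ∈ E → E.card = F + 1 → ∀ y : P,
      ε ^ m * ∑ σ ∈ univ.filter (fun σ : Fin (m + 1) → S => ∀ e ∈ E, σ e = τ e),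
        ∑ x ∈ univ.filter (fun x : Fin (m + 1) → P => x p = y), Φ σ x ≤ B)
    (T : Finset ι₀) (hT : T.card = F + 1) (ι : T → Fin (m + 1)) (hι : Function.Injective ι) (t : Fin (m + 1)) (s : T → S) :
    ∃ g : S → ℝ, (∀ σ₀, 0 ≤ g σ₀) ∧
      (∀ a : P × S, ε ^ m * ∑ Y ∈ univ.filter (fun Y : Fin (m + 1) → P × S => Y t = a),
          Φ (fun i => (Y i).2) (fun i => (Y i).1) * ∏ j : T, (if (Y (ι j)).2 = s j then (1 : ℝ) else 0) ≤ g a.2) ∧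
      ∑ σ₀, g σ₀ ≤ B := by
  classical
  refine ⟨fun σ₀ => ε ^ m * ∑ Y ∈ univ.filter (fun Y : Fin (m + 1) → P × S => Y t = ((0 : P), σ₀)),
      Φ (fun i => (Y i).2) (fun i => (Y i).1) * ∏ j : T, (if (Y (ι j)).2 = s j then (1 : ℝ) else 0), fun σ₀ => ?_, fun a => ?_, ?_⟩
  · exact mul_nonneg (pow_nonneg hε m) (sum_nonneg fun Y _ => mul_nonneg (hΦ0 _ _) (prod_nonneg fun j _ => by split_ifs <;> norm_num))
  · obtain ⟨y, σ₀⟩ := a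
    exact le_of_eq (by rw [sum_prescribedSlots_translate Φ hΦ T ι s t σ₀ y 0])
  · rw [← mul_sum, sum_sum_prescribedSlots_eq_posPinnedSlots]
    exact sum_posPinnedSlots_le_of_prescribedSum_le Φ hΦ hB T hT ι hι t s 0

end Profile

section HubbardProfile

open GrassmannAlgebra Literature.Probability.LatticeModels

variable {L M : ℕ} [NeZero L] {N : ℕ} {ι₀ : Type*}

/-- **THE SWAPPED INPUT OF THE SECTOR PREIMAGE AS A SECTOR PROFILE** (the `∃ g` shape of the oriented tree-decay lemma's `hKsw`, Hubbard form): if the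
sectorised kernels of `G` are translation invariant in norm and every standard sectorised prescribed sum of `W_F(G)` in degree `m + 1` with `Fc + 1` legs held
fixed is `≤ B`, then for every `T` with `|T| = Fc + 1`, injective `ι`, slot `t` and labels `s` there is `g ≥ 0` on the sector labels with
`Σ_{Y : Y t = a} ‖kernel (sectorPreimage β F G) (m+1) Y‖ · ∏_{j : T} [ (Y (ι j)).2 = s j ] ≤ g a.2` for EVERY full label `a`, and `Σ_{σ₀} g σ₀ ≤ ε_x · B`.
[cite: BenfattoGiulianiMastropietro2006, §2.8 (2.88)-(2.90), App. A3 Lemma A3.1, App. A4 (A4.8)] -/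
theorem exists_sectorProfile_kernel_sectorPreimage_of_prescribedSum_le [NeZero M] {β : ℝ} (hβ : 0 ≤ β)
    (F : Fin N → FreqMomentum L M → ℂ) (G : HubbardGrassmann L M) (m : ℕ)
    (hG : ∀ (σ : Fin (m + 1) → SectorLeg N) (x : Fin (m + 1) → SpaceTimeIdx L M) (a : SpaceTimeIdx L M),
      ‖sectorisedKernel L M β F G (m + 1) σ (fun i => ((x i).1 + a.1, (x i).2 + a.2))‖ = ‖sectorisedKernel L M β F G (m + 1) σ x‖)
    {Fc : ℕ} {B : ℝ}
    (hB : ∀ (E : Finset (Fin (m + 1))) (τ : Fin (m + 1) → SectorLeg N) (p : Fin (m + 1)), p ∈ E → E.card = Fc + 1 →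
      ∀ y : SpaceTimeIdx L M,
        imagTimeWeight β M ^ m * ∑ σ ∈ univ.filter (fun σ : Fin (m + 1) → SectorLeg N => ∀ e ∈ E, σ e = τ e),
          ∑ x ∈ univ.filter (fun x : Fin (m + 1) → SpaceTimeIdx L M => x p = y), ‖sectorisedKernel L M β F G (m + 1) σ x‖ ≤ B)
    (T : Finset ι₀) (hT : T.card = Fc + 1) (ι : T → Fin (m + 1)) (hι : Function.Injective ι) (t : Fin (m + 1))
    (s : T → SectorLeg N) :
    ∃ g : SectorLeg N → ℝ, (∀ σ₀, 0 ≤ g σ₀) ∧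
      (∀ a : SpaceTimeIdx L M × SectorLeg N,
        ∑ Y ∈ univ.filter (fun Y : Fin (m + 1) → SpaceTimeIdx L M × SectorLeg N => Y t = a),
          ‖kernel ℂ (sectorPreimage β F G) (m + 1) Y‖ * ∏ j : T, (if (Y (ι j)).2 = s j then (1 : ℝ) else 0) ≤ g a.2) ∧
      ∑ σ₀, g σ₀ ≤ imagTimeWeight β M * B := by
  classical
  haveI : NeZero (2 * M) := ⟨by have := NeZero.ne M; omega⟩
  set c : ℂ := ((imagTimeWeight β M : ℝ) : ℂ) ^ (m + 1) with hc
  have hK : ∀ Y : Fin (m + 1) → SpaceTimeIdx L M × SectorLeg N, ‖kernel ℂ (sectorPreimage β F G) (m + 1) Y‖ =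
      ‖(c • sectorisedKernel L M β F G (m + 1)) (fun i => (Y i).2) (fun i => (Y i).1)‖ := by
    intro Y
    rw [kernel_sectorPreimage_eq_sectorisedKernel β F G (m + 1) Y, Pi.smul_apply, Pi.smul_apply, smul_eq_mul]
  have hΦ : ∀ (σ : Fin (m + 1) → SectorLeg N) (x : Fin (m + 1) → SpaceTimeIdx L M) (a : SpaceTimeIdx L M),
      ‖(c • sectorisedKernel L M β F G (m + 1)) σ (fun i => x i + a)‖ = ‖(c • sectorisedKernel L M β F G (m + 1)) σ x‖ := by
    intro σ x a
    simp only [Pi.smul_apply, smul_eq_mul, norm_mul]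
    exact congrArg _ (hG σ x a)
  refine ⟨fun σ₀ => ∑ Y ∈ univ.filter (fun Y : Fin (m + 1) → SpaceTimeIdx L M × SectorLeg N => Y t = ((0 : SpaceTimeIdx L M), σ₀)),
      ‖kernel ℂ (sectorPreimage β F G) (m + 1) Y‖ * ∏ j : T, (if (Y (ι j)).2 = s j then (1 : ℝ) else 0), fun σ₀ => ?_, fun a => ?_, ?_⟩
  · exact sum_nonneg fun Y _ => mul_nonneg (norm_nonneg _) (prod_nonneg fun j _ => by split_ifs <;> norm_num)
  · obtain ⟨y, σ₀⟩ := a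
    refine le_of_eq ?_
    simp_rw [hK]
    exact sum_prescribedSlots_translate (fun σ x => ‖(c • sectorisedKernel L M β F G (m + 1)) σ x‖) hΦ T ι s t σ₀ y 0
  · rw [sum_sum_prescribedSlots_eq_posPinnedSlots]
    exact sum_norm_kernel_sectorPreimage_posPinnedSlots_le_of_prescribedSum_le hβ F G m hG hB T hT ι hι t s 0

end HubbardProfile

/-! ### The level-`0` companion: a sector profile for ANY prescribed set, with the crude count `|S|` (no translation of the pin needed onto a prescribed
leg — there may be none) -/

section ProfileCard

variable {S P : Type*} [Fintype S] [DecidableEq S] [Fintype P] [DecidableEq P] {ι₀ : Type*}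

omit [Fintype P] [DecidableEq P] in
/-- The leg set `insert t (range ι)` has `|T| + 1` elements when `ι` is injective and misses `t`. [folklore] -/
private theorem card_insert_image_eq_sw {m : ℕ} (T : Finset ι₀) (ι : T → Fin (m + 1)) (hι : Function.Injective ι) (t : Fin (m + 1))
    (ht : ∀ j : T, ι j ≠ t) : (insert t ((univ : Finset T).image ι)).card = T.card + 1 := by
  classical
  rw [card_insert_of_notMem, card_image_of_injective _ hι, card_univ, Fintype.card_coe]
  simp only [mem_image, mem_univ, true_and, not_exists]
  exact fun j => ht j

/-- **The standard bridge for a real size function** (`sum_norm_prescribedSlots_le_of_prescribedSum_le` is the case `Φ σ x = ‖W σ x‖`): the standard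
hypothesis at `F` bounds the FULL-pin indicator sum with `|T| = F` prescribed slots, `ι` injective missing the pinned slot `t`.
[cite: BenfattoGiulianiMastropietro2006, §2.8 (2.88)-(2.90), App. A3 Lemma A3.1] -/
theorem sum_prescribedSlots_le_of_prescribedSum_le' {ε : ℝ} {m : ℕ} (Φ : (Fin (m + 1) → S) → (Fin (m + 1) → P) → ℝ) {F : ℕ} {B : ℝ}
    (hB : ∀ (E : Finset (Fin (m + 1))) (τ : Fin (m + 1) → S) (p : Fin (m + 1)), p ∈ E → E.card = F + 1 → ∀ y : P,
      ε ^ m * ∑ σ ∈ univ.filter (fun σ : Fin (m + 1) → S => ∀ e ∈ E, σ e = τ e),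
        ∑ x ∈ univ.filter (fun x : Fin (m + 1) → P => x p = y), Φ σ x ≤ B)
    (T : Finset ι₀) (hT : T.card = F) (ι : T → Fin (m + 1)) (hι : Function.Injective ι) (t : Fin (m + 1))
    (ht : ∀ j : T, ι j ≠ t) (s : T → S) (a : P × S) :
    ε ^ m * ∑ Y ∈ univ.filter (fun Y : Fin (m + 1) → P × S => Y t = a),
        Φ (fun i => (Y i).2) (fun i => (Y i).1) * ∏ j : T, (if (Y (ι j)).2 = s j then (1 : ℝ) else 0) ≤ B := by
  classical
  set τ : Fin (m + 1) → S := fun e => if h : ∃ j : T, ι j = e then s (Classical.choose h) else a.2 with hτ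
  have hτt : τ t = a.2 := by
    simp only [hτ]
    rw [dif_neg]
    rintro ⟨j, hj⟩
    exact ht j hj
  have hτι : ∀ j : T, τ (ι j) = s j := by
    intro j
    have hex : ∃ j' : T, ι j' = ι j := ⟨j, rfl⟩
    simp only [hτ]
    rw [dif_pos hex, hι (Classical.choose_spec hex)]
  rw [sum_prescribedSlots_eq' Φ T ι s t a, prescribedSlots_filter_eq T ι s t a τ hτt hτι]
  exact hB _ τ t (mem_insert_self _ _) (by rw [card_insert_image_eq_sw T ι hι t ht, hT]) a.1

/-- **A SECTOR PROFILE AT THE SAME LEVEL, CRUDE COUNT** (serves the oriented tree-decay lemma's `hKsw` where no prescribed slot is available to re-pin at,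
e.g. `T = ∅`): for a nonnegative translation-invariant `Φ`, the standard hypothesis at `F`, `|T| = F`, `ι` injective missing `t`, there is `g ≥ 0` with
`ε^m · Σ_{Y : Y t = a} Φ · ∏[…] ≤ g a.2` for every `a` and `Σ_{σ₀} g σ₀ ≤ |S| · B` (each `g σ₀ ≤ B` by the standard bridge).
[cite: BenfattoGiulianiMastropietro2006, §2.8 (2.88)-(2.90), App. A4 (A4.8)] -/
theorem exists_sectorProfile_of_prescribedSum_le_card [AddGroup P] {ε : ℝ} (hε : 0 ≤ ε) {m : ℕ} (Φ : (Fin (m + 1) → S) → (Fin (m + 1) → P) → ℝ)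
    (hΦ0 : ∀ σ x, 0 ≤ Φ σ x) (hΦ : ∀ (σ : Fin (m + 1) → S) (x : Fin (m + 1) → P) (a : P), Φ σ (fun i => x i + a) = Φ σ x) {F : ℕ} {B : ℝ}
    (hB : ∀ (E : Finset (Fin (m + 1))) (τ : Fin (m + 1) → S) (p : Fin (m + 1)), p ∈ E → E.card = F + 1 → ∀ y : P,
      ε ^ m * ∑ σ ∈ univ.filter (fun σ : Fin (m + 1) → S => ∀ e ∈ E, σ e = τ e),
        ∑ x ∈ univ.filter (fun x : Fin (m + 1) → P => x p = y), Φ σ x ≤ B)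
    (T : Finset ι₀) (hT : T.card = F) (ι : T → Fin (m + 1)) (hι : Function.Injective ι) (t : Fin (m + 1))
    (ht : ∀ j : T, ι j ≠ t) (s : T → S) :
    ∃ g : S → ℝ, (∀ σ₀, 0 ≤ g σ₀) ∧
      (∀ a : P × S, ε ^ m * ∑ Y ∈ univ.filter (fun Y : Fin (m + 1) → P × S => Y t = a),
          Φ (fun i => (Y i).2) (fun i => (Y i).1) * ∏ j : T, (if (Y (ι j)).2 = s j then (1 : ℝ) else 0) ≤ g a.2) ∧
      ∑ σ₀, g σ₀ ≤ Fintype.card S * B := by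
  classical
  refine ⟨fun σ₀ => ε ^ m * ∑ Y ∈ univ.filter (fun Y : Fin (m + 1) → P × S => Y t = ((0 : P), σ₀)),
      Φ (fun i => (Y i).2) (fun i => (Y i).1) * ∏ j : T, (if (Y (ι j)).2 = s j then (1 : ℝ) else 0), fun σ₀ => ?_, fun a => ?_, ?_⟩
  · exact mul_nonneg (pow_nonneg hε m) (sum_nonneg fun Y _ => mul_nonneg (hΦ0 _ _) (prod_nonneg fun j _ => by split_ifs <;> norm_num))
  · obtain ⟨y, σ₀⟩ := a
    exact le_of_eq (by rw [sum_prescribedSlots_translate Φ hΦ T ι s t σ₀ y 0])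
  · calc ∑ σ₀ : S, ε ^ m * ∑ Y ∈ univ.filter (fun Y : Fin (m + 1) → P × S => Y t = ((0 : P), σ₀)),
          Φ (fun i => (Y i).2) (fun i => (Y i).1) * ∏ j : T, (if (Y (ι j)).2 = s j then (1 : ℝ) else 0)
        ≤ ∑ _σ₀ : S, B := sum_le_sum fun σ₀ _ => sum_prescribedSlots_le_of_prescribedSum_le' Φ hB T hT ι hι t ht s (0, σ₀)
      _ = Fintype.card S * B := by rw [sum_const, card_univ, nsmul_eq_mul]

end ProfileCard

section HubbardProfileCard

open GrassmannAlgebra Literature.Probability.LatticeModels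

variable {L M : ℕ} [NeZero L] {N : ℕ} {ι₀ : Type*}

/-- **A SECTOR PROFILE FOR THE SECTOR PREIMAGE AT THE SAME LEVEL, CRUDE COUNT** (Hubbard form of `exists_sectorProfile_of_prescribedSum_le_card`; the
oriented tree-decay lemma's `hKsw` at the vertices where no prescribed slot is left, e.g. BGM level `0`): translation-invariant `W_F(G)`, the standard
hypothesis at `Fc`, `|T| = Fc`, `ι` injective missing `t` ⇒ `∃ g ≥ 0`, `Σ_{Y : Y t = a} ‖kernel (sectorPreimage β F G) (m+1) Y‖ · ∏[…] ≤ g a.2` for every `a`,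
`Σ_{σ₀} g σ₀ ≤ |SectorLeg N| · (ε_x · B)`. [cite: BenfattoGiulianiMastropietro2006, §2.8 (2.88)-(2.90), App. A4 (A4.8)] -/
theorem exists_sectorProfile_kernel_sectorPreimage_of_prescribedSum_le_card [NeZero M] {β : ℝ} (hβ : 0 ≤ β)
    (F : Fin N → FreqMomentum L M → ℂ) (G : HubbardGrassmann L M) (m : ℕ)
    (hG : ∀ (σ : Fin (m + 1) → SectorLeg N) (x : Fin (m + 1) → SpaceTimeIdx L M) (a : SpaceTimeIdx L M),
      ‖sectorisedKernel L M β F G (m + 1) σ (fun i => ((x i).1 + a.1, (x i).2 + a.2))‖ = ‖sectorisedKernel L M β F G (m + 1) σ x‖)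
    {Fc : ℕ} {B : ℝ}
    (hB : ∀ (E : Finset (Fin (m + 1))) (τ : Fin (m + 1) → SectorLeg N) (p : Fin (m + 1)), p ∈ E → E.card = Fc + 1 →
      ∀ y : SpaceTimeIdx L M,
        imagTimeWeight β M ^ m * ∑ σ ∈ univ.filter (fun σ : Fin (m + 1) → SectorLeg N => ∀ e ∈ E, σ e = τ e),
          ∑ x ∈ univ.filter (fun x : Fin (m + 1) → SpaceTimeIdx L M => x p = y), ‖sectorisedKernel L M β F G (m + 1) σ x‖ ≤ B)
    (T : Finset ι₀) (hT : T.card = Fc) (ι : T → Fin (m + 1)) (hι : Function.Injective ι) (t : Fin (m + 1)) (ht : ∀ j : T, ι j ≠ t)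
    (s : T → SectorLeg N) :
    ∃ g : SectorLeg N → ℝ, (∀ σ₀, 0 ≤ g σ₀) ∧
      (∀ a : SpaceTimeIdx L M × SectorLeg N,
        ∑ Y ∈ univ.filter (fun Y : Fin (m + 1) → SpaceTimeIdx L M × SectorLeg N => Y t = a),
          ‖kernel ℂ (sectorPreimage β F G) (m + 1) Y‖ * ∏ j : T, (if (Y (ι j)).2 = s j then (1 : ℝ) else 0) ≤ g a.2) ∧
      ∑ σ₀, g σ₀ ≤ Fintype.card (SectorLeg N) * (imagTimeWeight β M * B) := by
  classical
  haveI : NeZero (2 * M) := ⟨by have := NeZero.ne M; omega⟩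
  have hε : 0 ≤ imagTimeWeight β M := imagTimeWeight_nonneg hβ M
  set c : ℂ := ((imagTimeWeight β M : ℝ) : ℂ) ^ (m + 1) with hc
  have hK : ∀ Y : Fin (m + 1) → SpaceTimeIdx L M × SectorLeg N, ‖kernel ℂ (sectorPreimage β F G) (m + 1) Y‖ =
      ‖(c • sectorisedKernel L M β F G (m + 1)) (fun i => (Y i).2) (fun i => (Y i).1)‖ := by
    intro Y
    rw [kernel_sectorPreimage_eq_sectorisedKernel β F G (m + 1) Y, Pi.smul_apply, Pi.smul_apply, smul_eq_mul]
  have hΦ : ∀ (σ : Fin (m + 1) → SectorLeg N) (x : Fin (m + 1) → SpaceTimeIdx L M) (a : SpaceTimeIdx L M),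
      ‖(c • sectorisedKernel L M β F G (m + 1)) σ (fun i => x i + a)‖ = ‖(c • sectorisedKernel L M β F G (m + 1)) σ x‖ := by
    intro σ x a
    simp only [Pi.smul_apply, smul_eq_mul, norm_mul]
    exact congrArg _ (hG σ x a)
  refine ⟨fun σ₀ => ∑ Y ∈ univ.filter (fun Y : Fin (m + 1) → SpaceTimeIdx L M × SectorLeg N => Y t = ((0 : SpaceTimeIdx L M), σ₀)),
      ‖kernel ℂ (sectorPreimage β F G) (m + 1) Y‖ * ∏ j : T, (if (Y (ι j)).2 = s j then (1 : ℝ) else 0), fun σ₀ => ?_, fun a => ?_, ?_⟩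
  · exact sum_nonneg fun Y _ => mul_nonneg (norm_nonneg _) (prod_nonneg fun j _ => by split_ifs <;> norm_num)
  · obtain ⟨y, σ₀⟩ := a
    refine le_of_eq ?_
    simp_rw [hK]
    exact sum_prescribedSlots_translate (fun σ x => ‖(c • sectorisedKernel L M β F G (m + 1)) σ x‖) hΦ T ι s t σ₀ y 0
  · calc ∑ σ₀ : SectorLeg N, ∑ Y ∈ univ.filter (fun Y : Fin (m + 1) → SpaceTimeIdx L M × SectorLeg N => Y t = ((0 : SpaceTimeIdx L M), σ₀)),
          ‖kernel ℂ (sectorPreimage β F G) (m + 1) Y‖ * ∏ j : T, (if (Y (ι j)).2 = s j then (1 : ℝ) else 0)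
        ≤ ∑ _σ₀ : SectorLeg N, imagTimeWeight β M * B :=
          sum_le_sum fun σ₀ _ => sum_norm_kernel_sectorPreimage_prescribedSlots_le_of_prescribedSum_le hβ F G m hB T hT ι hι t ht s _
      _ = Fintype.card (SectorLeg N) * (imagTimeWeight β M * B) := by rw [sum_const, card_univ, nsmul_eq_mul]

end HubbardProfileCard

end Literature.MathematicalPhysics.QuantumLattice

end
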